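import Summits.SmoothPoincare4.SmoothPoincare4.Theses.EntropyRung
import Summits.SmoothPoincare4.SmoothPoincare4.Theorems.EntropyRungSubcylindricalExistenceEntropyLocalisation
import Summits.SmoothPoincare4.SmoothPoincare4.Theorems.EntropyRungSubcylindricalExistenceWeightComparison
import Summits.SmoothPoincare4.SmoothPoincare4.Theorems.EntropyRungSubcylindricalExistenceLargeScale
import HarnessLib

/-!
# Comparison of weighted `𝒲`-clauses, integral form of the gradient discrepancy (helper W4)

Helper for the crux `SubcylindricalExistence` (ENT), route `EntropyRung`, line
`fat-conical-core-avr-logsobolev`, stub `helper_weightComparison`. On `(M, g, dV_g)` the `w²`-form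
of Perelman's `𝒲` for `ψ² g` is `∫ (τ (r w² + 4 ψ⁻² |∇w|²) − w² log w² − 4 w²) c ψ⁴ dV_g`,
`c = (4πτ)⁻²`. **`helper_weightComparison`:** if on a region `U`, `e^{-κ} ≤ ψ₁/ψ₀ ≤ e^{κ}` and
`r₁ ≥ (1−κ₀)e^{−2κ} r₀`, and the `ψ₀`-clause holds at level `L` at every scale for test functions
supported in `U`, then the `ψ₁`-functional of every normalised `w` supported in `U` is
`≥ L + 2 log(1−κ₀) − 8κ − (16 τ/κ₀) E`, where
`E = ∫ c w² ψ₁² |∇ log(ψ₁/ψ₀)|² dV_g` is the gradient discrepancy, kept as an integral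
(substitute `v = (ψ₁/ψ₀)² w`, `u = s v`, `s = (1−κ₀)e^{−2κ}`, apply the `ψ₀`-clause at scale `sτ`;
Young's inequality for the inverse metric bounds the gradient density pointwise). This is the
integral-form variant of `wClause_weight_comparison` (same file family), whose pointwise lemmas are
reused. Perelman 2002 §3 / Topping 2006 (8.1.8) for the `w`-form; the comparison is folklore.
-/

noncomputable section

open scoped Manifold ContDiff Topology ENNReal NNReal
open Set Filter MeasureTheory
open Literature.Geometry.Lorentzian Literature.Geometry.Riemannian

set_option linter.dupNamespace false

namespace Summit.SmoothPoincare4.SmoothPoincare4.Theorems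

namespace WeightComparisonIntegral

/-- **Scalar core of the pointwise comparison, integral-discrepancy form** (`m = c V² P⁴`,
`s = (1−κ₀)e^{−2κ}`, Young bound with parameter `κ₀`, `|l| ≤ κ`, `s r₀ ≤ r₁`); the discrepancy
`(16τ/κ₀) c (e^{-2l}V)² (e^l P)² Λ` is kept on the left. -/
theorem scalar_core {τ c κ₀ κ r₀ r₁ P l A Λ B V s : ℝ}
    (hτ : 0 < τ) (hc : 0 < c) (hκ₀ : 0 < κ₀) (hκ₀1 : κ₀ < 1) (hs : s = (1 - κ₀) * Real.exp (-2 * κ))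
    (hl1 : -κ ≤ l) (hl2 : l ≤ κ) (hA : 0 ≤ A) (hΛ : 0 ≤ Λ) (hP : 0 < P) (hr : s * r₀ ≤ r₁)
    (hyoung : 4 * V * B ≤ κ₀ * A + 4 * V ^ 2 * Λ / κ₀) :
    (s * τ) * r₀ * (c * V ^ 2 * P ^ 4) + 4 * (s * τ) * c * P ^ 2 * A - Real.log (s ^ 2) * (c * V ^ 2 * P ^ 4)
        + (2 * Real.log s - 4 * κ) * (c * V ^ 2 * P ^ 4)
        - 16 * τ / κ₀ * (c * (Real.exp (-2 * l) * V) ^ 2 * (Real.exp l * P) ^ 2 * Λ)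
      ≤ τ * r₁ * (c * V ^ 2 * P ^ 4)
        + 4 * τ * c * ((Real.exp l * P) ^ 2 * (Real.exp (-2 * l) ^ 2 * (A - 4 * V * B + 4 * V ^ 2 * Λ)))
        + 4 * l * (c * V ^ 2 * P ^ 4) := by
  set m : ℝ := c * V ^ 2 * P ^ 4 with hm
  have hm0 : 0 ≤ m := by positivity
  have hT1 : (s * τ) * r₀ * m ≤ τ * r₁ * m := by
    have h1 : τ * (s * r₀) ≤ τ * r₁ := mul_le_mul_of_nonneg_left hr hτ.le
    have h3 := mul_le_mul_of_nonneg_right h1 hm0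
    have e : (s * τ) * r₀ * m = τ * (s * r₀) * m := by ring
    rw [e]; exact h3
  set X : ℝ := Real.exp (-2 * l) with hX
  have hX0 : 0 < X := Real.exp_pos _
  have hXlo : Real.exp (-2 * κ) ≤ X := by rw [hX, Real.exp_le_exp]; linarith
  have hEX : (Real.exp l * P) ^ 2 * (Real.exp (-2 * l) ^ 2) = P ^ 2 * X := by
    have h : Real.exp l ^ 2 * Real.exp (-2 * l) ^ 2 = Real.exp (-2 * l) := by
      rw [← Real.exp_nat_mul, ← Real.exp_nat_mul, ← Real.exp_add]; congr 1; push_cast; ring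
    rw [hX]; linear_combination P ^ 2 * h
  have hEX' : (Real.exp (-2 * l) * V) ^ 2 * (Real.exp l * P) ^ 2 = X * V ^ 2 * P ^ 2 := by
    have h : Real.exp (-2 * l) ^ 2 * Real.exp l ^ 2 = Real.exp (-2 * l) := by
      rw [← Real.exp_nat_mul, ← Real.exp_nat_mul, ← Real.exp_add]; congr 1; push_cast; ring
    rw [hX]; linear_combination V ^ 2 * P ^ 2 * h
  have hT2 : 4 * (s * τ) * c * P ^ 2 * A
        - 16 * τ / κ₀ * (c * (Real.exp (-2 * l) * V) ^ 2 * (Real.exp l * P) ^ 2 * Λ)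
      ≤ 4 * τ * c * ((Real.exp l * P) ^ 2 * (Real.exp (-2 * l) ^ 2 * (A - 4 * V * B + 4 * V ^ 2 * Λ))) := by
    have e0 : 4 * τ * c * ((Real.exp l * P) ^ 2 * (Real.exp (-2 * l) ^ 2 * (A - 4 * V * B + 4 * V ^ 2 * Λ))) =
        4 * τ * c * (P ^ 2 * X) * (A - 4 * V * B + 4 * V ^ 2 * Λ) := by
      rw [← hEX]; ring
    have e1 : 16 * τ / κ₀ * (c * (Real.exp (-2 * l) * V) ^ 2 * (Real.exp l * P) ^ 2 * Λ) =
        16 * τ / κ₀ * (c * (X * V ^ 2 * P ^ 2) * Λ) := by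
      rw [← hEX']; ring
    rw [e0, e1]
    have hfac : 0 ≤ 4 * τ * c * (P ^ 2 * X) := by positivity
    have hY : (1 - κ₀) * A + 4 * V ^ 2 * Λ - 4 * V ^ 2 * Λ / κ₀ ≤ A - 4 * V * B + 4 * V ^ 2 * Λ := by linarith
    have step1 := mul_le_mul_of_nonneg_left hY hfac
    have step2 : 4 * τ * c * P ^ 2 * Real.exp (-2 * κ) * ((1 - κ₀) * A) ≤ 4 * τ * c * P ^ 2 * X * ((1 - κ₀) * A) := by
      have h1 : 0 ≤ (1 - κ₀) * A := mul_nonneg (by linarith) hA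
      have h2 : 0 ≤ 4 * τ * c * P ^ 2 := by positivity
      exact mul_le_mul_of_nonneg_right (mul_le_mul_of_nonneg_left hXlo h2) h1
    have step3 : 0 ≤ 4 * τ * c * (P ^ 2 * X) * (4 * V ^ 2 * Λ) := by positivity
    have e3 : 4 * (s * τ) * c * P ^ 2 * A = 4 * τ * c * P ^ 2 * Real.exp (-2 * κ) * ((1 - κ₀) * A) := by rw [hs]; ring
    have e4 : 4 * τ * c * (P ^ 2 * X) * ((1 - κ₀) * A + 4 * V ^ 2 * Λ - 4 * V ^ 2 * Λ / κ₀) =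
        4 * τ * c * P ^ 2 * X * ((1 - κ₀) * A) + 4 * τ * c * (P ^ 2 * X) * (4 * V ^ 2 * Λ)
          - 16 * τ / κ₀ * (c * (X * V ^ 2 * P ^ 2) * Λ) := by
      field_simp
      ring
    rw [e3]
    linarith [step1, step2, step3, e4]
  have hT3 : -4 * κ * m ≤ 4 * l * m := by nlinarith
  have hlog : Real.log (s ^ 2) = 2 * Real.log s := by rw [Real.log_pow]; push_cast; ring
  rw [hlog]
  nlinarith [hT1, hT2, hT3, hm0]

end WeightComparisonIntegral

open WeightComparison WeightComparisonIntegral in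
/-- **Helper W4 (registered stub `helper_weightComparison`) — comparison of weighted
`𝒲`-clauses under a change of weight, with the gradient discrepancy kept as an integral.**
See the module docstring. -/
theorem helper_weightComparison :
    ∀ (M : Type) [TopologicalSpace M] [T2Space M] [SecondCountableTopology M]
      [ChartedSpace (EuclideanSpace ℝ (Fin 4)) M] [IsManifold (𝓡 4) ∞ M] [CompactSpace M]
      [T3Space M] [MeasurableSpace M] [BorelSpace M]
      (g : PseudoRiemannianMetric (𝓡 4) ∞ (EuclideanSpace ℝ (Fin 4)) (TangentSpace (𝓡 4) : M → Type _))
      [g.HasLeviCivita] (hg : g.IsRiemannian) (U : Set M) (ψ₀ ψ₁ r₀ r₁ : M → ℝ) (L κ κ₀ : ℝ),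
      ContMDiff (𝓡 4) 𝓘(ℝ, ℝ) ∞ ψ₀ → ContMDiff (𝓡 4) 𝓘(ℝ, ℝ) ∞ ψ₁ → (∀ x, 0 < ψ₀ x) → (∀ x, 0 < ψ₁ x) →
      Continuous r₀ → Continuous r₁ → 0 ≤ κ → 0 < κ₀ → κ₀ < 1 →
      (∀ x ∈ U, Real.exp (-κ) ≤ ψ₁ x / ψ₀ x ∧ ψ₁ x / ψ₀ x ≤ Real.exp κ) →
      (∀ x ∈ U, 0 ≤ r₀ x) → (∀ x ∈ U, (1 - κ₀) * Real.exp (-2 * κ) * r₀ x ≤ r₁ x) →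
      (∀ s : ℝ, 0 < s → ∀ w : M → ℝ, ContMDiff (𝓡 4) 𝓘(ℝ, ℝ) ∞ w → tsupport w ⊆ U →
        ∫ x, (4 * Real.pi * s) ^ (-(4 : ℝ) / 2) * (w x) ^ 2 * (ψ₀ x) ^ 4
            ∂(riemannianMeasure (g.toContMDiffRiemannianMetric hg)) = 1 →
          L ≤ ∫ x, (s * (r₀ x * (w x) ^ 2 + 4 * ((ψ₀ x)⁻¹ ^ 2 * g.gradSq w x))
              - (w x) ^ 2 * Real.log ((w x) ^ 2) - 4 * (w x) ^ 2)
              * ((4 * Real.pi * s) ^ (-(4 : ℝ) / 2) * (ψ₀ x) ^ 4)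
            ∂(riemannianMeasure (g.toContMDiffRiemannianMetric hg))) →
      ∀ τ : ℝ, 0 < τ → ∀ w : M → ℝ, ContMDiff (𝓡 4) 𝓘(ℝ, ℝ) ∞ w → tsupport w ⊆ U →
        ∫ x, (4 * Real.pi * τ) ^ (-(4 : ℝ) / 2) * (w x) ^ 2 * (ψ₁ x) ^ 4
            ∂(riemannianMeasure (g.toContMDiffRiemannianMetric hg)) = 1 →
          L + 2 * Real.log (1 - κ₀) - 8 * κ
            - 16 * τ / κ₀ * ∫ x, (4 * Real.pi * τ) ^ (-(4 : ℝ) / 2) * (w x) ^ 2 * (ψ₁ x) ^ 2 *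
                g.gradSq (fun y ↦ Real.log (ψ₁ y / ψ₀ y)) x
                ∂(riemannianMeasure (g.toContMDiffRiemannianMetric hg)) ≤
            ∫ x, (τ * (r₁ x * (w x) ^ 2 + 4 * ((ψ₁ x)⁻¹ ^ 2 * g.gradSq w x))
              - (w x) ^ 2 * Real.log ((w x) ^ 2) - 4 * (w x) ^ 2)
              * ((4 * Real.pi * τ) ^ (-(4 : ℝ) / 2) * (ψ₁ x) ^ 4)
            ∂(riemannianMeasure (g.toContMDiffRiemannianMetric hg)) := by
  intro M _ _ _ _ _ _ _ _ _ g _ hg U ψ₀ ψ₁ r₀ r₁ L κ κ₀ hψ₀ hψ₁ h0 h1 hr₀c hr₁c hκ hκ₀ hκ₀1 hρ _hr₀ hr hclause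
    τ hτ w hw hsupp hnorm
  classical
  set μ : Measure M := riemannianMeasure (g.toContMDiffRiemannianMetric hg) with hμ
  set c : ℝ := (4 * Real.pi * τ) ^ (-(4 : ℝ) / 2) with hc
  set s : ℝ := (1 - κ₀) * Real.exp (-2 * κ) with hs
  set ℓ : M → ℝ := fun y ↦ Real.log (ψ₁ y / ψ₀ y) with hℓ
  set v : M → ℝ := fun y ↦ Real.exp (2 * ℓ y) * w y with hv
  set u : M → ℝ := fun y ↦ s * v y with hu
  have hs0 : 0 < s := mul_pos (by linarith) (Real.exp_pos _)
  have hc0 : 0 < c := Real.rpow_pos_of_pos (by positivity) _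
  have hτ' : 0 < s * τ := mul_pos hs0 hτ
  have hratio : ∀ y, Real.exp (ℓ y) = ψ₁ y / ψ₀ y := fun y ↦ Real.exp_log (div_pos (h1 y) (h0 y))
  have hψ₁eq : ∀ y, ψ₁ y = Real.exp (ℓ y) * ψ₀ y := by
    intro y; rw [hratio y, div_mul_cancel₀ _ (h0 y).ne']
  have hwv : ∀ y, w y = Real.exp (-2 * ℓ y) * v y := fun y ↦ by
    simp only [hv]
    rw [← mul_assoc, ← Real.exp_add, show -2 * ℓ y + 2 * ℓ y = 0 by ring, Real.exp_zero, one_mul]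
  have hwv_ev : ∀ y, w =ᶠ[𝓝 y] fun z ↦ Real.exp (-2 * ℓ z) * v z := fun y ↦ Eventually.of_forall hwv
  have hw_ev0 : ∀ y ∉ U, w =ᶠ[𝓝 y] fun _ ↦ 0 := fun y hy ↦
    notMem_tsupport_iff_eventuallyEq.1 fun h ↦ hy (hsupp h)
  have hv_of_w : ∀ z, w z = 0 → v z = 0 := fun z hz ↦ by simp only [hv, hz, mul_zero]
  have hv_ev0 : ∀ y ∉ U, v =ᶠ[𝓝 y] fun _ ↦ 0 := fun y hy ↦ (hw_ev0 y hy).mono fun z hz ↦ hv_of_w z hz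
  have hu_ev0 : ∀ y ∉ U, u =ᶠ[𝓝 y] fun _ ↦ 0 := fun y hy ↦ (hv_ev0 y hy).mono fun z hz ↦ by
    simp only [hu, hz, mul_zero]
  have hℓs : ContMDiff (𝓡 4) 𝓘(ℝ, ℝ) ∞ ℓ := by
    intro y
    have hq : ContMDiff (𝓡 4) 𝓘(ℝ, ℝ) ∞ (fun z ↦ ψ₁ z / ψ₀ z) := hψ₁.div₀ hψ₀ fun z ↦ (h0 z).ne'
    have hne : ψ₁ y / ψ₀ y ≠ 0 := (div_pos (h1 y) (h0 y)).ne'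
    exact (Real.contDiffAt_log.mpr hne).comp_contMDiffAt (f := fun z ↦ ψ₁ z / ψ₀ z) (hq y)
  have hvs : ContMDiff (𝓡 4) 𝓘(ℝ, ℝ) ∞ v := by
    have h2ℓ : ContMDiff (𝓡 4) 𝓘(ℝ, ℝ) ∞ (fun z ↦ 2 * ℓ z) := contMDiff_const.mul hℓs
    have hexp : ContMDiff (𝓡 4) 𝓘(ℝ, ℝ) ∞ (fun z ↦ Real.exp (2 * ℓ z)) :=
      Real.contDiff_exp.comp_contMDiff h2ℓ
    exact hexp.mul hw
  have hus : ContMDiff (𝓡 4) 𝓘(ℝ, ℝ) ∞ u := contMDiff_const.mul hvs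
  have hsuppu : tsupport u ⊆ U := by
    refine Subset.trans (closure_mono fun z hz ↦ ?_) hsupp
    intro hwz
    exact hz (by simp only [hu, hv_of_w z hwz, mul_zero])
  have hmass : ∀ y, c * (w y) ^ 2 * (ψ₁ y) ^ 4 = c * (v y) ^ 2 * (ψ₀ y) ^ 4 := by
    intro y
    rw [hwv y, hψ₁eq y]
    linear_combination (c * v y ^ 2 * ψ₀ y ^ 4) * exp_neg_two_sq_mul_exp_pow_four (ℓ y)
  have hc' : (4 * Real.pi * (s * τ)) ^ (-(4 : ℝ) / 2) = c / s ^ 2 := normConst_rescale hs0 hτ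
  have hnormu : ∫ y, (4 * Real.pi * (s * τ)) ^ (-(4 : ℝ) / 2) * (u y) ^ 2 * (ψ₀ y) ^ 4 ∂μ = 1 := by
    have h1 : ∀ y, c / s ^ 2 * (u y) ^ 2 * (ψ₀ y) ^ 4 = c * (w y) ^ 2 * (ψ₁ y) ^ 4 := fun y ↦ by
      rw [hmass y]; simp only [hu]; field_simp
    rw [hc']; simp_rw [h1]; exact hnorm
  have hL := hclause (s * τ) hτ' u hus hsuppu hnormu
  rw [hc'] at hL
  set K : ℝ := 2 * Real.log s - 4 * κ with hK
  have hpt : ∀ y, (s * τ * (r₀ y * (u y) ^ 2 + 4 * ((ψ₀ y)⁻¹ ^ 2 * g.gradSq u y))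
          - (u y) ^ 2 * Real.log ((u y) ^ 2) - 4 * (u y) ^ 2) * (c / s ^ 2 * (ψ₀ y) ^ 4)
        + K * (c * (v y) ^ 2 * (ψ₀ y) ^ 4)
        - 16 * τ / κ₀ * (c * (w y) ^ 2 * (ψ₁ y) ^ 2 * g.gradSq ℓ y) ≤
      (τ * (r₁ y * (w y) ^ 2 + 4 * ((ψ₁ y)⁻¹ ^ 2 * g.gradSq w y)) - (w y) ^ 2 * Real.log ((w y) ^ 2)
        - 4 * (w y) ^ 2) * (c * (ψ₁ y) ^ 4) := by
    intro y
    by_cases hy : y ∈ U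
    · have hP : 0 < ψ₀ y := h0 y
      have hℓy : MDifferentiableAt (𝓡 4) 𝓘(ℝ, ℝ) ℓ y := (hℓs y).mdifferentiableAt (by simp)
      have hvy : MDifferentiableAt (𝓡 4) 𝓘(ℝ, ℝ) v y := (hvs y).mdifferentiableAt (by simp)
      set P := ψ₀ y with hPdef
      set l := ℓ y with hl
      set A := g.gradSq v y with hA
      set Λ := g.gradSq ℓ y with hΛdef
      set B := g.innerDual y (mvfderiv (𝓡 4) ℓ y : TangentSpace (𝓡 4) y →ₗ[ℝ] ℝ)
        (mvfderiv (𝓡 4) v y : TangentSpace (𝓡 4) y →ₗ[ℝ] ℝ) with hB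
      set V := v y with hV
      have hA0 : 0 ≤ A := g.gradSq_nonneg hg v y
      have hΛ0 : 0 ≤ Λ := g.gradSq_nonneg hg ℓ y
      have hl1 : -κ ≤ l := by
        have := Real.log_le_log (Real.exp_pos _) (hρ y hy).1; rwa [Real.log_exp] at this
      have hl2 : l ≤ κ := by
        have := Real.log_le_log (div_pos (h1 y) (h0 y)) (hρ y hy).2; rwa [Real.log_exp] at this
      have hyoung : 4 * V * B ≤ κ₀ * A + 4 * V ^ 2 * Λ / κ₀ := four_mul_innerDual_le g hg y _ _ V hκ₀
      have hgradw : g.gradSq w y = Real.exp (-2 * l) ^ 2 * (A - 4 * V * B + 4 * V ^ 2 * Λ) :=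
        gradSq_exp_neg_two_mul_mul g (hwv_ev y) hℓy hvy
      have hgradu : g.gradSq u y = s ^ 2 * A := g.gradSq_const_mul v s y
      have hwy : w y = Real.exp (-2 * l) * V := hwv y
      have hψ₁y : ψ₁ y = Real.exp l * P := hψ₁eq y
      have huy : u y = s * V := rfl
      have hE4 := exp_neg_two_sq_mul_exp_pow_four l
      have hEP : Real.exp l * P ≠ 0 := (mul_pos (Real.exp_pos _) hP).ne'
      rw [hgradw, hgradu, hwy, hψ₁y, huy, density_expand _ _ _ _ _ _ hEP, density_expand _ _ _ _ _ _ hP.ne']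
      have hlog1 : (Real.exp (-2 * l) * V) ^ 2 * Real.log ((Real.exp (-2 * l) * V) ^ 2) * (c * (Real.exp l * P) ^ 4) =
          (V ^ 2 * Real.log (V ^ 2)) * (c * P ^ 4) - 4 * l * (c * V ^ 2 * P ^ 4) := by
        rw [EntropyLocalisation.sq_mul_log_sq_mul, log_exp_neg_two_sq]
        linear_combination (c * P ^ 4 * (V ^ 2 * Real.log (V ^ 2)) - 4 * l * (c * V ^ 2 * P ^ 4)) * hE4
      have hlog0 : (s * V) ^ 2 * Real.log ((s * V) ^ 2) * (c / s ^ 2 * P ^ 4) =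
          (V ^ 2 * Real.log (V ^ 2)) * (c * P ^ 4) + Real.log (s ^ 2) * (c * V ^ 2 * P ^ 4) := by
        rw [EntropyLocalisation.sq_mul_log_sq_mul]
        field_simp
      have hm1 : c * (Real.exp (-2 * l) * V) ^ 2 * (Real.exp l * P) ^ 4 = c * V ^ 2 * P ^ 4 := by
        linear_combination (c * V ^ 2 * P ^ 4) * hE4
      have hm0 : c / s ^ 2 * (s * V) ^ 2 * P ^ 4 = c * V ^ 2 * P ^ 4 := by field_simp
      have hg0 : 4 * (s * τ) * (c / s ^ 2) * (P ^ 2 * (s ^ 2 * A)) = 4 * (s * τ) * c * P ^ 2 * A := by field_simp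
      rw [hlog1, hlog0, hm1, hm0, hg0]
      have key := scalar_core (r₀ := r₀ y) (r₁ := r₁ y) (B := B) (V := V) hτ hc0 hκ₀ hκ₀1 hs hl1 hl2 hA0 hΛ0 hP
        (hr y hy) hyoung
      linarith [key]
    · simp [(hw_ev0 y hy).eq_of_nhds, (hv_ev0 y hy).eq_of_nhds, (hu_ev0 y hy).eq_of_nhds,
        gradSq_eq_zero_of_eventuallyEq_zero g (hw_ev0 y hy), gradSq_eq_zero_of_eventuallyEq_zero g (hu_ev0 y hy)]
  have hμfin : IsFiniteMeasure μ := isFiniteMeasure_riemannianMeasure _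
  have hint : ∀ {F : M → ℝ}, Continuous F → Integrable F μ := fun hF ↦
    EntropyLocalisation.integrable_of_continuous_finite hF μ
  have hI1 : Integrable (fun y ↦ (τ * (r₁ y * (w y) ^ 2 + 4 * ((ψ₁ y)⁻¹ ^ 2 * g.gradSq w y))
      - (w y) ^ 2 * Real.log ((w y) ^ 2) - 4 * (w y) ^ 2) * (c * (ψ₁ y) ^ 4)) μ :=
    hint (LargeScale.continuous_density g hψ₁ h1 hr₁c hw τ c)
  have hI0 : Integrable (fun y ↦ (s * τ * (r₀ y * (u y) ^ 2 + 4 * ((ψ₀ y)⁻¹ ^ 2 * g.gradSq u y))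
      - (u y) ^ 2 * Real.log ((u y) ^ 2) - 4 * (u y) ^ 2) * (c / s ^ 2 * (ψ₀ y) ^ 4)) μ :=
    hint (LargeScale.continuous_density g hψ₀ h0 hr₀c hus (s * τ) (c / s ^ 2))
  have hvw : (fun y ↦ c * (v y) ^ 2 * (ψ₀ y) ^ 4) = fun y ↦ c * (w y) ^ 2 * (ψ₁ y) ^ 4 :=
    funext fun y ↦ (hmass y).symm
  have hIm : Integrable (fun y ↦ c * (v y) ^ 2 * (ψ₀ y) ^ 4) μ :=
    hint ((continuous_const.mul (hvs.continuous.pow 2)).mul (hψ₀.continuous.pow 4))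
  have hIE : Integrable (fun y ↦ c * (w y) ^ 2 * (ψ₁ y) ^ 2 * g.gradSq ℓ y) μ :=
    hint (((continuous_const.mul (hw.continuous.pow 2)).mul (hψ₁.continuous.pow 2)).mul
      (contMDiff_gradSq g hℓs).continuous)
  have hmass_int : ∫ y, c * (v y) ^ 2 * (ψ₀ y) ^ 4 ∂μ = 1 := by rw [hvw]; exact hnorm
  have hImK : Integrable (fun y ↦ K * (c * (v y) ^ 2 * (ψ₀ y) ^ 4)) μ := hIm.const_mul K
  have hIadd : Integrable (fun y ↦ (s * τ * (r₀ y * (u y) ^ 2 + 4 * ((ψ₀ y)⁻¹ ^ 2 * g.gradSq u y))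
      - (u y) ^ 2 * Real.log ((u y) ^ 2) - 4 * (u y) ^ 2) * (c / s ^ 2 * (ψ₀ y) ^ 4)
        + K * (c * (v y) ^ 2 * (ψ₀ y) ^ 4)) μ := hI0.add hImK
  have hIEc : Integrable (fun y ↦ 16 * τ / κ₀ * (c * (w y) ^ 2 * (ψ₁ y) ^ 2 * g.gradSq ℓ y)) μ :=
    hIE.const_mul _
  have hIall : Integrable (fun y ↦ (s * τ * (r₀ y * (u y) ^ 2 + 4 * ((ψ₀ y)⁻¹ ^ 2 * g.gradSq u y))
      - (u y) ^ 2 * Real.log ((u y) ^ 2) - 4 * (u y) ^ 2) * (c / s ^ 2 * (ψ₀ y) ^ 4)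
        + K * (c * (v y) ^ 2 * (ψ₀ y) ^ 4)
        - 16 * τ / κ₀ * (c * (w y) ^ 2 * (ψ₁ y) ^ 2 * g.gradSq ℓ y)) μ := hIadd.sub hIEc
  have hmono := integral_mono hIall hI1 fun y ↦ hpt y
  rw [integral_sub hIadd hIEc, integral_add hI0 hImK, integral_const_mul, integral_const_mul, hmass_int,
    mul_one] at hmono
  have hlogs : Real.log s = Real.log (1 - κ₀) + -2 * κ := by
    rw [hs, Real.log_mul (by linarith) (Real.exp_pos _).ne', Real.log_exp]
  have hKval : K = 2 * Real.log (1 - κ₀) - 4 * κ - 4 * κ := by rw [hK, hlogs]; ring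
  linarith [hL, hmono, hKval]

end Summit.SmoothPoincare4.SmoothPoincare4.Theorems

end
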